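import Summits.Parity.GeneralizedHardyLittlewood.Theorems.PrimeLevelFamEdgeMomentsBeyondDiagonalLayersClassUniform
import Summits.Parity.GeneralizedHardyLittlewood.Theorems.PrimeLevelFamEdgeMomentsBeyondDiagonalLayersClassReduction
import Summits.Parity.GeneralizedHardyLittlewood.Theorems.PrimeLevelFamEdgeMomentsBeyondDiagonalLayersClassSums
import HarnessLib

/-!
# Route `PrimeLevelFamEdge`, crux K_A `MomentsBeyondDiagonal` (stmt-Parity-20007), line «petersson_layers» v4:
# `stub_farP` FROM PASCADI'S THEOREM 7.1 (assembly step E7 — the class and block sums and the final instantiation)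

The uniform per-class bound `…LayersClassUniform.classTerm_le_uniform` is summed over the sharp classes
(`Σ_{s ≤ X, s ∣ (qr)^∞} s^{−1/12} ≤ C_ε (qr)^ε`) and over the blocks (`Σ_{d ≤ M} 1/d ≤ 1 + 2log q`) by `…LayersClassSums`,
the divisor bounds are instantiated (`τ(n) ≤ C₁ n^{ε₁} ≤ C₁ (qr)^{4ε₁}`), the logarithms are absorbed
(`…LayersClassSums.logFactor_cube_le_rpow`) and the exponents are compared
(`Δ' + 1 + η/2 − 13/600 + 1/1000 + 10·(9/50000) ≤ 2 − 1/1000` for `Δ' ≤ 101/100`, `η = 1/1000`): this is the hypothesis of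
`…LayersClassReduction.subFar_rhoP_of_classSum_bound` on the window `(1, 101/100]` with `δ = η = 1/1000`, whence
* **`subFar_rhoP_of_pascadi : pascadi2025_theorem71 → SubFar rhoP`** — the registered signature of `stub_farP`, CONDITIONAL on
  the named fact `Literature.NumberTheory.LFunctions.pascadi2025_theorem71` (Pascadi, GAFA 2026, Thm 7.1; statement layer in the
  tree, proof NOT formalised).  By-name closure of `stub_farP` would need `pascadi2025_theorem71_holds` (Pascadi §§4–7), which
  is not attempted here.
Proof only (def-free, CONDITIONAL); K_A / K_B / Parity NOT proved; nothing about Landau–Siegel zeros.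
-/

noncomputable section

open scoped Real Nat
open Complex Finset Polynomial MeasureTheory
open Literature.NumberTheory.LFunctions
open Literature.NumberTheory.Sieve

namespace Summit.Parity.GeneralizedHardyLittlewood.Theorems.MomentsBeyondDiagonal.Layers

open Summit.Parity.GeneralizedHardyLittlewood.Theorems.PrimeLevelFamEdgeIdeaDeltas.PeterssonLayers
/-- **`stub_farP` (its registered signature `SubFar rhoP`) CONDITIONAL on Pascadi's Theorem 7.1.**
[cite: Pascadi2025, Thm. 7.1] -/
theorem subFar_rhoP_of_pascadi (h : pascadi2025_theorem71) : SubFar rhoP := by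
  refine subFar_rhoP_of_classSum_bound (Δ₀ := 101 / 100) (by norm_num) le_rfl fun P _ Δ' hΔ1 hΔ2 ↦ ?_
  refine ⟨1 / 1000, 1 / 1000, by norm_num, by norm_num, by norm_num, fun i j ↦ ?_⟩
  -- constants
  set B : ℝ := ∑ k ∈ range (P.natDegree + 1), |P.coeff k| with hBdef
  have hB : ∀ t ∈ Set.Icc (0 : ℝ) 1, |P.eval t| ≤ B := fun t ht ↦ abs_eval_le_sum_abs_coeff P ht
  have hB0 : 0 ≤ B := le_trans (abs_nonneg _) (hB 0 (by simp))
  obtain ⟨Kw, hKw0, hKw⟩ := weight_mul_sqrt_le_rpow i j (le_refl (0 : ℝ))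
  obtain ⟨Cu, hCu0, hCu⟩ := classTerm_le_uniform h (ε := 1 / 10000) (by norm_num)
  obtain ⟨C₁, hC₁1, hC₁⟩ := exists_card_divisors_le_mul_rpow' (ε := 1 / 100000) (by norm_num)
  obtain ⟨Cc, hCc0, hCc⟩ := sum_rpow_neg_twelfth_factored_le (ε := 1 / 100000) (by norm_num)
  obtain ⟨Cl, hCl0, hCl⟩ := logFactor_cube_le_rpow i j
  have hC₁0 : 0 ≤ C₁ := by linarith
  refine ⟨Cu * (C₁ * B ^ 2 * Kw * Cl) * Cc ^ 4 * (4 * π ^ 2) ^ (9 / 50000 : ℝ) / (4 * π ^ 2), 64, ?_⟩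
  intro q _ hq h64 _ r _ hr
  -- the band
  have hqh1 : 1 < KMV2000.qhat q := one_lt_qhat h64
  have hqh0 : 0 < KMV2000.qhat q := zero_lt_one.trans hqh1
  have hq1 : 1 ≤ q := le_trans (by norm_num) h64
  have hrlo : KMV2000.qhat q ^ (11 / 10 : ℝ) < r := qhat_rpow_lt_of_mem_band h64 hΔ1 (mem_Icc.mp hr).1
  have hrhi : (r : ℝ) ≤ KMV2000.qhat q ^ (8 : ℝ) :=
    le_qhat_rpow_eight_of_mem_band h64 hΔ1 (by linarith) (mem_Icc.mp hr).2
  have hr0 : (0 : ℝ) < r := lt_trans (Real.rpow_pos_of_pos hqh0 _) hrlo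
  have hr1 : (1 : ℝ) ≤ r := by exact_mod_cast Nat.one_le_iff_ne_zero.mpr (by rintro rfl; simp at hr0)
  have hq' : (q : ℝ) = 4 * π ^ 2 * KMV2000.qhat q ^ 2 := natCast_eq_four_pi_sq_mul_qhat_sq q
  have hq0 : (0 : ℝ) < q := by rw [hq']; positivity
  have hqr0 : q * r ≠ 0 := NeZero.ne _
  have hπ1 : (1 : ℝ) ≤ 4 * π ^ 2 :=
    (by norm_num : (1 : ℝ) ≤ 4 * 9).trans (mul_le_mul_of_nonneg_left nine_le_pi_sq (by norm_num))
  have hQ0 : 0 < (q : ℝ) * r := by positivity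
  have hqQ : (q : ℝ) ≤ (q : ℝ) * r := le_mul_of_one_le_right hq0.le hr1
  have hQ1 : 1 ≤ (q : ℝ) * r := le_trans (by exact_mod_cast hq1) hqQ
  have hQcast : ((q * r : ℕ) : ℝ) = (q : ℝ) * r := by push_cast; ring
  -- `M² ≤ qr`, `M ≤ q²`
  have hMx : ((⌊KMV2000.qhat q ^ Δ'⌋₊ : ℕ) : ℝ) ≤ KMV2000.qhat q ^ (101 / 100 : ℝ) :=
    (Nat.floor_le (Real.rpow_nonneg hqh0.le _)).trans (Real.rpow_le_rpow_of_exponent_le hqh1.le hΔ2)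
  have hM2Q : ((⌊KMV2000.qhat q ^ Δ'⌋₊ * ⌊KMV2000.qhat q ^ Δ'⌋₊ : ℕ) : ℝ) ≤ (q : ℝ) * r := by
    push_cast
    calc ((⌊KMV2000.qhat q ^ Δ'⌋₊ : ℕ) : ℝ) * ((⌊KMV2000.qhat q ^ Δ'⌋₊ : ℕ) : ℝ)
        ≤ KMV2000.qhat q ^ (101 / 100 : ℝ) * KMV2000.qhat q ^ (101 / 100 : ℝ) :=
          mul_le_mul hMx hMx (Nat.cast_nonneg _) (Real.rpow_nonneg hqh0.le _)
      _ ≤ KMV2000.qhat q ^ (2 : ℝ) * KMV2000.qhat q ^ (11 / 10 : ℝ) := by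
          rw [← Real.rpow_add hqh0, ← Real.rpow_add hqh0]
          exact Real.rpow_le_rpow_of_exponent_le hqh1.le (by norm_num)
      _ ≤ KMV2000.qhat q ^ (2 : ℝ) * r := mul_le_mul_of_nonneg_left hrlo.le (Real.rpow_nonneg hqh0.le _)
      _ = 1 * (KMV2000.qhat q ^ 2 * r) := by rw [Real.rpow_two]; ring
      _ ≤ 4 * π ^ 2 * (KMV2000.qhat q ^ 2 * r) := mul_le_mul_of_nonneg_right hπ1 (by positivity)
      _ = (q : ℝ) * r := by rw [hq']; ring
  have hMq2 : ⌊KMV2000.qhat q ^ Δ'⌋₊ ≤ q ^ 2 := by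
    have h1 : ((⌊KMV2000.qhat q ^ Δ'⌋₊ : ℕ) : ℝ) ≤ (q : ℝ) := by
      calc ((⌊KMV2000.qhat q ^ Δ'⌋₊ : ℕ) : ℝ) ≤ KMV2000.qhat q ^ (101 / 100 : ℝ) := hMx
        _ ≤ KMV2000.qhat q ^ (2 : ℝ) := Real.rpow_le_rpow_of_exponent_le hqh1.le (by norm_num)
        _ = 1 * KMV2000.qhat q ^ 2 := by rw [Real.rpow_two, one_mul]
        _ ≤ 4 * π ^ 2 * KMV2000.qhat q ^ 2 := mul_le_mul_of_nonneg_right hπ1 (sq_nonneg _)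
        _ = q := hq'.symm
    have h2 : ⌊KMV2000.qhat q ^ Δ'⌋₊ ≤ q := by exact_mod_cast h1
    exact h2.trans (Nat.le_self_pow two_ne_zero q)
  -- divisor bounds
  obtain ⟨D, hD⟩ : ∃ D : ℝ, D = C₁ * ((q : ℝ) * r) ^ (4 / 100000 : ℝ) := ⟨_, rfl⟩
  have hD0 : 0 ≤ D := by rw [hD]; positivity
  have hD₁ : ∀ u ∈ Icc 1 (⌊KMV2000.qhat q ^ Δ'⌋₊ * ⌊KMV2000.qhat q ^ Δ'⌋₊), (#u.divisors : ℝ) ≤ D := by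
    intro u hu
    have huQ : (u : ℝ) ≤ (q : ℝ) * r := le_trans (by exact_mod_cast (mem_Icc.mp hu).2) hM2Q
    rw [hD]
    calc (#u.divisors : ℝ) ≤ C₁ * (u : ℝ) ^ (1 / 100000 : ℝ) := hC₁ u
      _ ≤ C₁ * ((q : ℝ) * r) ^ (1 / 100000 : ℝ) :=
          mul_le_mul_of_nonneg_left (Real.rpow_le_rpow (Nat.cast_nonneg _) huQ (by norm_num)) hC₁0
      _ ≤ C₁ * ((q : ℝ) * r) ^ (4 / 100000 : ℝ) :=
          mul_le_mul_of_nonneg_left (Real.rpow_le_rpow_of_exponent_le hQ1 (by norm_num)) hC₁0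
  have hD₂ : ∀ v ∈ Icc 1 (q ^ 2 * q ^ 2), (#v.divisors : ℝ) ≤ D := by
    intro v hv
    have hvq : (v : ℝ) ≤ (q : ℝ) ^ (4 : ℝ) := by
      have h1 : v ≤ q ^ 4 := (mem_Icc.mp hv).2.trans (by rw [← pow_add])
      rw [show (4 : ℝ) = ((4 : ℕ) : ℝ) by norm_num, Real.rpow_natCast]
      exact_mod_cast h1
    rw [hD]
    calc (#v.divisors : ℝ) ≤ C₁ * (v : ℝ) ^ (1 / 100000 : ℝ) := hC₁ v
      _ ≤ C₁ * ((q : ℝ) ^ (4 : ℝ)) ^ (1 / 100000 : ℝ) :=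
          mul_le_mul_of_nonneg_left (Real.rpow_le_rpow (Nat.cast_nonneg _) hvq (by norm_num)) hC₁0
      _ = C₁ * (q : ℝ) ^ (4 / 100000 : ℝ) := by rw [← Real.rpow_mul hq0.le]; norm_num
      _ ≤ C₁ * ((q : ℝ) * r) ^ (4 / 100000 : ℝ) :=
          mul_le_mul_of_nonneg_left (Real.rpow_le_rpow hq0.le hqQ (by norm_num)) hC₁0
  -- the class count
  have hS : ∀ X : ℕ, ∑ s ∈ (Icc 1 X).filter (fun s ↦ s ∈ Nat.factoredNumbers (q * r).primeFactors),
      ((s : ℝ)) ^ (-(1 / 12 : ℝ)) ≤ Cc * ((q : ℝ) * r) ^ (1 / 100000 : ℝ) := fun X ↦ by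
    have h1 := hCc (q * r) hqr0 X
    rwa [hQcast] at h1
  -- the per-class bound
  have hterm := hCu q h64 hq r hrlo P B hB Δ' hΔ1 hΔ2 (1 / 1000) (by norm_num) (by norm_num) i j Kw hKw0
    (fun hN₁ hN₂ ↦ hKw h64 hN₁ hN₂) D D hD0 hD0 hD₁ hD₂
  have hlq : 0 ≤ Real.log (q : ℝ) := Real.log_nonneg (by exact_mod_cast hq1)
  have hL0 : 0 ≤ ((1 + Real.log (KMV2000.qhat q)) * (1 + 2 * Real.log q)) ^ (i + j) :=
    pow_nonneg (mul_nonneg (by linarith [Real.log_nonneg hqh1.le]) (by linarith)) _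
  obtain ⟨G, hG⟩ : ∃ G : ℝ, G = Cu * (Real.sqrt D * Real.sqrt D * B ^ 2 * Kw *
      ((1 + Real.log (KMV2000.qhat q)) * (1 + 2 * Real.log q)) ^ (i + j) * Real.sqrt (1 + 2 * Real.log q)) *
      KMV2000.qhat q ^ (Δ' + 1 + 1 / 1000 / 2 - 13 / 600) * ((q : ℝ) * r) ^ (1 + 1 / 10000 : ℝ) := ⟨_, rfl⟩
  have hG0 : 0 ≤ G := by rw [hG]; positivity
  -- §A the per-class bounds, summed
  have hstep : ∑ d₁ ∈ Icc 1 ⌊KMV2000.qhat q ^ Δ'⌋₊, ∑ d₂ ∈ Icc 1 ⌊KMV2000.qhat q ^ Δ'⌋₊,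
      ∑ s₁ ∈ (Icc 1 (⌊KMV2000.qhat q ^ Δ'⌋₊ / d₁)).filter (fun s ↦ s ∈ Nat.factoredNumbers (q * r).primeFactors),
      ∑ t₁ ∈ (Icc 1 (q ^ 2 / d₁)).filter (fun s ↦ s ∈ Nat.factoredNumbers (q * r).primeFactors),
      ∑ s₂ ∈ (Icc 1 (⌊KMV2000.qhat q ^ Δ'⌋₊ / d₂)).filter (fun s ↦ s ∈ Nat.factoredNumbers (q * r).primeFactors),
      ∑ t₂ ∈ (Icc 1 (q ^ 2 / d₂)).filter (fun s ↦ s ∈ Nat.factoredNumbers (q * r).primeFactors),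
        (((q * r).totient : ℝ) / (((q * r) / Nat.gcd (Nat.gcd (s₁ * t₁) (s₂ * t₂)) (q * r)).totient : ℝ)) *
        ‖∑ f₁ ∈ Icc 1 (⌊KMV2000.qhat q ^ Δ'⌋₊ / d₁ / s₁), ∑ h₁ ∈ Icc 1 (q ^ 2 / d₁ / t₁),
          ∑ f₂ ∈ Icc 1 (⌊KMV2000.qhat q ^ Δ'⌋₊ / d₂ / s₂), ∑ h₂ ∈ Icc 1 (q ^ 2 / d₂ / t₂),
            (if Nat.Coprime f₁ (q * r) ∧ Nat.Coprime f₂ (q * r) then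
                (KMV2000.mollifierCoeff P (KMV2000.qhat q ^ Δ') (d₁ * (s₁ * f₁)) : ℂ) *
                  (KMV2000.mollifierCoeff P (KMV2000.qhat q ^ Δ') (d₂ * (s₂ * f₂)) : ℂ) *
                  ((Real.sqrt ((s₁ * f₁ : ℕ) : ℝ) * Real.sqrt ((s₂ * f₂ : ℕ) : ℝ) : ℝ) : ℂ) else 0) *
              (if Nat.Coprime h₁ (q * r) ∧ Nat.Coprime h₂ (q * r) then
                  (if d₁ * (t₁ * h₁) * (d₂ * (t₂ * h₂)) ≤ ⌈KMV2000.qhat q ^ (2 + 1 / 1000 : ℝ)⌉₊ then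
                      ((((((d₁ * (t₁ * h₁) : ℕ) : ℝ) * ((d₂ * (t₂ * h₂) : ℕ) : ℝ)) ^ (-(1 / 2 : ℝ)) : ℝ) : ℂ) *
                        afeW (KMV2000.qhat q) i j (d₁ * (t₁ * h₁)) (d₂ * (t₂ * h₂))) else 0) *
                    ((Real.sqrt ((t₁ * h₁ : ℕ) : ℝ) * Real.sqrt ((t₂ * h₂ : ℕ) : ℝ) : ℝ) : ℂ) else 0) *
              @kloostermanSum ((q * r) / Nat.gcd (Nat.gcd (s₁ * t₁) (s₂ * t₂)) (q * r))
                (neZero_div_classGcd (q * r) (s₁ * t₁) (s₂ * t₂))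
                ((s₁ * t₁ / Nat.gcd (Nat.gcd (s₁ * t₁) (s₂ * t₂)) (q * r) * (f₁ * f₂) : ℕ) :
                  ZMod ((q * r) / Nat.gcd (Nat.gcd (s₁ * t₁) (s₂ * t₂)) (q * r)))
                ((s₂ * t₂ / Nat.gcd (Nat.gcd (s₁ * t₁) (s₂ * t₂)) (q * r) * (h₁ * h₂) : ℕ) :
                  ZMod ((q * r) / Nat.gcd (Nat.gcd (s₁ * t₁) (s₂ * t₂)) (q * r)))‖ ≤
      ∑ d₁ ∈ Icc 1 ⌊KMV2000.qhat q ^ Δ'⌋₊, ∑ d₂ ∈ Icc 1 ⌊KMV2000.qhat q ^ Δ'⌋₊,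
      ∑ s₁ ∈ (Icc 1 (⌊KMV2000.qhat q ^ Δ'⌋₊ / d₁)).filter (fun s ↦ s ∈ Nat.factoredNumbers (q * r).primeFactors),
      ∑ t₁ ∈ (Icc 1 (q ^ 2 / d₁)).filter (fun s ↦ s ∈ Nat.factoredNumbers (q * r).primeFactors),
      ∑ s₂ ∈ (Icc 1 (⌊KMV2000.qhat q ^ Δ'⌋₊ / d₂)).filter (fun s ↦ s ∈ Nat.factoredNumbers (q * r).primeFactors),
      ∑ t₂ ∈ (Icc 1 (q ^ 2 / d₂)).filter (fun s ↦ s ∈ Nat.factoredNumbers (q * r).primeFactors),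
        G / ((d₁ : ℝ) * d₂) * (((s₁ * t₁ * (s₂ * t₂) : ℕ) : ℝ)) ^ (-(1 / 12 : ℝ)) := by
    refine sum_le_sum fun d₁ hd₁ ↦ sum_le_sum fun d₂ hd₂ ↦ sum_le_sum fun s₁ hs₁ ↦ sum_le_sum fun t₁ ht₁ ↦
      sum_le_sum fun s₂ hs₂ ↦ sum_le_sum fun t₂ ht₂ ↦ ?_
    have key := @hterm d₁ d₂ s₁ t₁ s₂ t₂ (Nat.gcd (Nat.gcd (s₁ * t₁) (s₂ * t₂)) (q * r))
      (neZero_div_classGcd (q * r) (s₁ * t₁) (s₂ * t₂)) hd₁ hd₂ (mem_filter.mp hs₁).1 (mem_filter.mp ht₁).1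
      (mem_filter.mp hs₂).1 (mem_filter.mp ht₂).1 rfl
    rw [hG]
    exact key
  -- §B the block and class sums
  have hsum : ∑ d₁ ∈ Icc 1 ⌊KMV2000.qhat q ^ Δ'⌋₊, ∑ d₂ ∈ Icc 1 ⌊KMV2000.qhat q ^ Δ'⌋₊,
      ∑ s₁ ∈ (Icc 1 (⌊KMV2000.qhat q ^ Δ'⌋₊ / d₁)).filter (fun s ↦ s ∈ Nat.factoredNumbers (q * r).primeFactors),
      ∑ t₁ ∈ (Icc 1 (q ^ 2 / d₁)).filter (fun s ↦ s ∈ Nat.factoredNumbers (q * r).primeFactors),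
      ∑ s₂ ∈ (Icc 1 (⌊KMV2000.qhat q ^ Δ'⌋₊ / d₂)).filter (fun s ↦ s ∈ Nat.factoredNumbers (q * r).primeFactors),
      ∑ t₂ ∈ (Icc 1 (q ^ 2 / d₂)).filter (fun s ↦ s ∈ Nat.factoredNumbers (q * r).primeFactors),
        G / ((d₁ : ℝ) * d₂) * (((s₁ * t₁ * (s₂ * t₂) : ℕ) : ℝ)) ^ (-(1 / 12 : ℝ)) ≤
      G * (1 + 2 * Real.log q) ^ 2 * (Cc * ((q : ℝ) * r) ^ (1 / 100000 : ℝ)) ^ 4 :=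
    sum_blocks_classes_le hq1 hMq2 (T := Cc * ((q : ℝ) * r) ^ (1 / 100000 : ℝ)) (by positivity) hS hG0
  -- §C the final scalar comparison
  have hsD : Real.sqrt D * Real.sqrt D = D := Real.mul_self_sqrt hD0
  have hlogs := hCl q h64
  have hQθ : ((q : ℝ) * r) ^ (4 / 100000 : ℝ) * ((q : ℝ) * r) ^ (1 + 1 / 10000 : ℝ) *
      (((q : ℝ) * r) ^ (1 / 100000 : ℝ)) ^ 4 = ((q : ℝ) * r) * ((q : ℝ) * r) ^ (9 / 50000 : ℝ) := by
    rw [← Real.rpow_natCast (((q : ℝ) * r) ^ (1 / 100000 : ℝ)) 4, ← Real.rpow_mul hQ0.le, ← Real.rpow_add hQ0,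
      ← Real.rpow_add hQ0]
    conv_rhs => rw [← Real.rpow_one ((q : ℝ) * r), ← Real.rpow_mul hQ0.le, ← Real.rpow_add hQ0]
    norm_num
  have hQ10 : (q : ℝ) * r ≤ 4 * π ^ 2 * KMV2000.qhat q ^ (10 : ℝ) := by
    rw [hq', show (10 : ℝ) = 2 + 8 by norm_num, Real.rpow_add hqh0, Real.rpow_two]
    calc 4 * π ^ 2 * KMV2000.qhat q ^ 2 * (r : ℝ) ≤ 4 * π ^ 2 * KMV2000.qhat q ^ 2 * KMV2000.qhat q ^ (8 : ℝ) :=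
          mul_le_mul_of_nonneg_left hrhi (by positivity)
      _ = _ := by ring
  have hQθle : ((q : ℝ) * r) ^ (9 / 50000 : ℝ) ≤ (4 * π ^ 2) ^ (9 / 50000 : ℝ) * KMV2000.qhat q ^ (9 / 5000 : ℝ) := by
    calc ((q : ℝ) * r) ^ (9 / 50000 : ℝ) ≤ (4 * π ^ 2 * KMV2000.qhat q ^ (10 : ℝ)) ^ (9 / 50000 : ℝ) :=
          Real.rpow_le_rpow hQ0.le hQ10 (by norm_num)
      _ = (4 * π ^ 2) ^ (9 / 50000 : ℝ) * (KMV2000.qhat q ^ (10 : ℝ)) ^ (9 / 50000 : ℝ) :=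
          Real.mul_rpow (by positivity) (Real.rpow_nonneg hqh0.le _)
      _ = (4 * π ^ 2) ^ (9 / 50000 : ℝ) * KMV2000.qhat q ^ (9 / 5000 : ℝ) := by
          rw [← Real.rpow_mul hqh0.le]; norm_num
  have hxexp : KMV2000.qhat q ^ (Δ' + 1 + 1 / 1000 / 2 - 13 / 600) * KMV2000.qhat q ^ (1 / 1000 : ℝ) *
      KMV2000.qhat q ^ (9 / 5000 : ℝ) ≤ KMV2000.qhat q ^ (2 : ℝ) * KMV2000.qhat q ^ (-(1 / 1000) : ℝ) := by
    rw [← Real.rpow_add hqh0, ← Real.rpow_add hqh0, ← Real.rpow_add hqh0]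
    exact Real.rpow_le_rpow_of_exponent_le hqh1.le (by linarith)
  have hK₁0 : 0 ≤ Cu * (C₁ * B ^ 2 * Kw * Cl) * Cc ^ 4 := by positivity
  have htarget : Cu * (C₁ * B ^ 2 * Kw * Cl) * Cc ^ 4 * (4 * π ^ 2) ^ (9 / 50000 : ℝ) / (4 * π ^ 2) *
      KMV2000.qhat q ^ (-(1 / 1000) : ℝ) * ((q : ℝ) * r) ^ 2 * ((r : ℝ))⁻¹ =
      Cu * (C₁ * B ^ 2 * Kw * Cl) * Cc ^ 4 * (4 * π ^ 2) ^ (9 / 50000 : ℝ) * ((q : ℝ) * r) *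
        (KMV2000.qhat q ^ (2 : ℝ) * KMV2000.qhat q ^ (-(1 / 1000) : ℝ)) := by
    rw [hq', Real.rpow_two]
    field_simp
  rw [htarget]
  refine hstep.trans (hsum.trans ?_)
  calc G * (1 + 2 * Real.log q) ^ 2 * (Cc * ((q : ℝ) * r) ^ (1 / 100000 : ℝ)) ^ 4
      = (Cu * B ^ 2 * Kw * Cc ^ 4) * (Real.sqrt D * Real.sqrt D) *
          (((1 + Real.log (KMV2000.qhat q)) * (1 + 2 * Real.log q)) ^ (i + j) * Real.sqrt (1 + 2 * Real.log q) *
            (1 + 2 * Real.log q) ^ 2) *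
          KMV2000.qhat q ^ (Δ' + 1 + 1 / 1000 / 2 - 13 / 600) *
          (((q : ℝ) * r) ^ (1 + 1 / 10000 : ℝ) * (((q : ℝ) * r) ^ (1 / 100000 : ℝ)) ^ 4) := by
        rw [hG]; ring
    _ ≤ (Cu * B ^ 2 * Kw * Cc ^ 4) * (C₁ * ((q : ℝ) * r) ^ (4 / 100000 : ℝ)) * (Cl * KMV2000.qhat q ^ (1 / 1000 : ℝ)) *
          KMV2000.qhat q ^ (Δ' + 1 + 1 / 1000 / 2 - 13 / 600) *
          (((q : ℝ) * r) ^ (1 + 1 / 10000 : ℝ) * (((q : ℝ) * r) ^ (1 / 100000 : ℝ)) ^ 4) := by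
        rw [hsD, hD]
        exact mul_le_mul_of_nonneg_right (mul_le_mul_of_nonneg_right
          (mul_le_mul_of_nonneg_left hlogs (by positivity)) (Real.rpow_nonneg hqh0.le _)) (by positivity)
    _ = (Cu * (C₁ * B ^ 2 * Kw * Cl) * Cc ^ 4) *
          (KMV2000.qhat q ^ (Δ' + 1 + 1 / 1000 / 2 - 13 / 600) * KMV2000.qhat q ^ (1 / 1000 : ℝ)) *
          (((q : ℝ) * r) ^ (4 / 100000 : ℝ) * ((q : ℝ) * r) ^ (1 + 1 / 10000 : ℝ) *
            (((q : ℝ) * r) ^ (1 / 100000 : ℝ)) ^ 4) := by ring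
    _ = (Cu * (C₁ * B ^ 2 * Kw * Cl) * Cc ^ 4) *
          (KMV2000.qhat q ^ (Δ' + 1 + 1 / 1000 / 2 - 13 / 600) * KMV2000.qhat q ^ (1 / 1000 : ℝ)) *
          (((q : ℝ) * r) * ((q : ℝ) * r) ^ (9 / 50000 : ℝ)) := by rw [hQθ]
    _ ≤ (Cu * (C₁ * B ^ 2 * Kw * Cl) * Cc ^ 4) *
          (KMV2000.qhat q ^ (Δ' + 1 + 1 / 1000 / 2 - 13 / 600) * KMV2000.qhat q ^ (1 / 1000 : ℝ)) *
          (((q : ℝ) * r) * ((4 * π ^ 2) ^ (9 / 50000 : ℝ) * KMV2000.qhat q ^ (9 / 5000 : ℝ))) :=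
        mul_le_mul_of_nonneg_left (mul_le_mul_of_nonneg_left hQθle hQ0.le) (by positivity)
    _ = (Cu * (C₁ * B ^ 2 * Kw * Cl) * Cc ^ 4) * (4 * π ^ 2) ^ (9 / 50000 : ℝ) * ((q : ℝ) * r) *
          (KMV2000.qhat q ^ (Δ' + 1 + 1 / 1000 / 2 - 13 / 600) * KMV2000.qhat q ^ (1 / 1000 : ℝ) *
            KMV2000.qhat q ^ (9 / 5000 : ℝ)) := by ring
    _ ≤ (Cu * (C₁ * B ^ 2 * Kw * Cl) * Cc ^ 4) * (4 * π ^ 2) ^ (9 / 50000 : ℝ) * ((q : ℝ) * r) *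
          (KMV2000.qhat q ^ (2 : ℝ) * KMV2000.qhat q ^ (-(1 / 1000) : ℝ)) :=
        mul_le_mul_of_nonneg_left hxexp (by positivity)

end Summit.Parity.GeneralizedHardyLittlewood.Theorems.MomentsBeyondDiagonal.Layers

end
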